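import Literature.Computability.Learning.LearnerParamsIneq
import Literature.Computability.Learning.NaturalLearningDistinguisher
import Literature.Computability.Complexity.CircuitLowerBounds
import HarnessLib

/-!
# The good level of the CIKK learner

Analysis instalment (M9b-2) of the decomposition of the named fact
`Literature.Computability.Learning.cikk_natural_implies_learning` (CIKK 2016, Thm. 5.1): the
NW output of level `ℓ` on a target of circuit size `≤ n^{k₀}` is a circuit of size
`≤ Q(recBound n a b k₀ ℓ + ℓ)` for the FIXED polynomial `Q = T5Q` of `circuitSizeOver_nwOutput_le`
and a bound `recBound` uniform in the target; a level is GOOD when this is below the circuit size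
of every member of `R ℓ`. Usefulness of `R` against `P/poly` yields good levels
(`exists_goodLevel`, quantitatively `goodLevel_of_large`), and at a good level the natural property
distinguishes the NW generator with advantage `≥ 1/5` for EVERY target in the size class
(`hadv_of_goodLevel`).

## References

* M. Carmosino, R. Impagliazzo, V. Kabanets, A. Kolokolova, *Learning algorithms from natural
  proofs*, CCC 2016, Lem. 3.4, Thm. 5.1 [CarmosinoImpagliazzoKabanetsKolokolova2016].
-/

namespace Literature.Computability.Learning

open Literature.Computability.Complexity Literature.Computability.Complexity.DirectProduct
  Literature.Computability.MetaComplexity Literature.Computability.Cryptography _root_.Computability Finset Filter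

/-! (Monotonicity `natPoly_eval_mono` and growth `natPoly_eval_le_eval_one_mul_pow` of `ℕ`-polynomials
come from `CircuitLowerBounds.lean`.) -/

/-! ### The fixed size polynomial and the uniform record bound -/

/-- **The size polynomial `Q` of the NW output** (`circuitSizeOver_nwOutput_le`). [cite: CarmosinoImpagliazzoKabanetsKolokolova2016, Lem. 3.4] -/
noncomputable def T5Q : Polynomial ℕ := Classical.choose circuitSizeOver_nwOutput_le

/-- Its defining property. [cite: CarmosinoImpagliazzoKabanetsKolokolova2016, Lem. 3.4] -/
theorem T5Q_spec : ∀ (n k ℓ q : ℕ) [Fact q.Prime] (hn : k * n + k ≤ q) (C : Circuit (Fin n)),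
    C.IsOver B2 → ∀ (pad : List Bool) (z : Fin (q * q) → Bool),
      circuitSizeOver B2 (fun v : Fin ℓ → Bool => ampFnFin (fun x => C.eval x) k (z ∘ cikkDesign q (k * n + k) ℓ hn v)) ≤
        T5Q.eval ((nwOutRecord (CircEval.desc C) pad q ℓ (k * n + k) n k (List.ofFn z)).length + ℓ) :=
  Classical.choose_spec circuitSizeOver_nwOutput_le

/-- A bound on the description length of a circuit of size `≤ n^{k₀}`. [folklore] -/
def descBound (n k₀ : ℕ) : ℕ := (n ^ k₀ + 1) * (8 * (n + n ^ k₀) + 10)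

/-- **The uniform bound on `|W| + ℓ`** at level `ℓ` for targets of size `≤ n^{k₀}`. [folklore] -/
def recBound (n a b k₀ ℓ : ℕ) : ℕ :=
  2 * descBound n k₀ + 2 * lvlQ n a b ℓ + 2 * ℓ + 2 * (lvlK n a b ℓ * n + lvlK n a b ℓ) + 2 * n + 2 * lvlK n a b ℓ +
    lvlQ n a b ℓ * lvlQ n a b ℓ + 16 + ℓ

/-- The record length is below the uniform bound. [folklore] -/
theorem length_nwOutRecord_add_le {n k₀ : ℕ} (a b ℓ : ℕ) (C : Circuit (Fin n)) (hC : C.size ≤ n ^ k₀)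
    (z : Fin (lvlQ n a b ℓ * lvlQ n a b ℓ) → Bool) :
    (nwOutRecord (CircEval.desc C) [] (lvlQ n a b ℓ) ℓ (lvlK n a b ℓ * n + lvlK n a b ℓ) n (lvlK n a b ℓ) (List.ofFn z)).length + ℓ ≤
      recBound n a b k₀ ℓ := by
  have hd : (CircEval.desc C).length ≤ descBound n k₀ := by
    refine (CircEval.length_desc_le C).trans ?_
    rw [descBound]
    exact Nat.mul_le_mul (by omega) (by omega)
  simp only [nwOutRecord, length_boolPair, List.length_replicate, List.length_nil, List.length_ofFn, recBound]
  omega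

/-! ### Good levels -/

/-- **A good level**: the NW-output size bound is below the circuit size of every member of `R ℓ`.
[cite: CarmosinoImpagliazzoKabanetsKolokolova2016, Thm. 5.1 (proof: choice of `ℓ`)] -/
def GoodLevel (R : CombinatorialProperty) (n a b k₀ ℓ : ℕ) : Prop :=
  ∀ g ∈ R ℓ, T5Q.eval (recBound n a b k₀ ℓ) < circuitSizeOver B2 g

/-- **At a good level the property distinguishes the generator**, for every target of size `≤ n^{k₀}`.
[cite: CarmosinoImpagliazzoKabanetsKolokolova2016, Lem. 3.4, Thm. 5.1] -/
theorem hadv_of_goodLevel {R : CombinatorialProperty} (hD : HasDensity 5 R) {n a b k₀ ℓ : ℕ} (hgood : GoodLevel R n a b k₀ ℓ)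
    {f : (Fin n → Bool) → Bool} (hf : f ∈ sizeClass B2 (fun n => n ^ k₀) n) :
    (1 / 5 : ℝ) ≤ advantage (natTest R ℓ)
      (nwGenerator (learnerDesign (lvlQ n a b ℓ) n (lvlK n a b ℓ) ℓ (lvl_hn n a b ℓ)) (ampFnFin f (lvlK n a b ℓ))) := by
  obtain ⟨C, hCo, hCf, hCs⟩ := hf
  exact natTest_advantage_learner_ge (fun n k ℓ q _ hn C hC pad z => T5Q_spec n k ℓ q hn C hC pad z) R (hD ℓ)
    (u := fun _ => T5Q.eval (recBound n a b k₀ ℓ)) hgood (lvl_hn n a b ℓ) C hCo hCf []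
    fun z => natPoly_eval_mono T5Q (length_nwOutRecord_add_le a b ℓ C hCs z)

/-! ### Growth of the record bound in `ℓ` -/

/-- The level-independent scale `K₀ = 2^{3s+31}` with `k ≤ K₀ (ℓ+1)`. [folklore] -/
def kScale (n a b : ℕ) : ℕ := 2 ^ (3 * prmS n a b + 31)

/-- `k ≤ K₀ (ℓ + 1)`. [folklore] -/
theorem lvlK_le (n a b ℓ : ℕ) : lvlK n a b ℓ ≤ kScale n a b * (ℓ + 1) := by
  obtain ⟨s, hs⟩ : ∃ s, prmS n a b = s := ⟨_, rfl⟩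
  have hK : lvlK n a b ℓ = 2 ^ (3 * s + 30) * 2 ^ Nat.size ℓ := by
    rw [lvlK, prmK, prmKappa, hs, ← pow_add]; exact congrArg (fun e => 2 ^ e) (by omega)
  have hS : kScale n a b = 2 ^ (3 * s + 30) * 2 := by rw [kScale, hs, ← pow_succ]
  rw [hK, hS, mul_assoc]
  refine Nat.mul_le_mul_left _ ?_
  -- `2^{size ℓ} ≤ 2(ℓ+1)`
  rcases Nat.eq_zero_or_pos ℓ with h0 | hpos
  · subst h0; simp
  · have hsz : 0 < Nat.size ℓ := Nat.size_pos.2 hpos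
    have hge : 2 ^ (Nat.size ℓ - 1) ≤ ℓ := by
      by_contra hc
      have := (Nat.size_le).2 (not_le.1 hc)
      omega
    have heq : 2 ^ Nat.size ℓ = 2 ^ (Nat.size ℓ - 1) * 2 := by
      rw [← pow_succ]; exact congrArg (fun e => 2 ^ e) (by omega)
    rw [heq]; omega

/-- **The growth constant**: `recBound n a b k₀ ℓ ≤ growA n a b k₀ · (ℓ+1)²`. [folklore] -/
def growA (n a b k₀ : ℕ) : ℕ :=
  2 * descBound n k₀ + 2 * n + 19 + 8 * kScale n a b * (n + 1) + 4 * kScale n a b ^ 2 * (n + 1) ^ 2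

/-- The record bound grows at most quadratically in the level. [folklore] -/
theorem recBound_le (n a b k₀ ℓ : ℕ) : recBound n a b k₀ ℓ ≤ growA n a b k₀ * (ℓ + 1) ^ 2 := by
  have hK := lvlK_le n a b ℓ
  have hKpos := lvlK_pos n a b ℓ
  have hq : lvlQ n a b ℓ ≤ 2 * (lvlK n a b ℓ * n + lvlK n a b ℓ) := prmQ_le _ (Nat.add_pos_right _ hKpos).ne'
  rw [recBound, growA]
  generalize lvlK n a b ℓ = K at hK hKpos hq ⊢
  generalize lvlQ n a b ℓ = q at hq ⊢
  generalize kScale n a b = K₀ at hK ⊢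
  generalize descBound n k₀ = dB
  obtain ⟨L, hL⟩ : ∃ L, ℓ + 1 = L := ⟨_, rfl⟩
  rw [hL] at hK ⊢
  have hL1 : 1 ≤ L := by omega
  have hℓL : ℓ ≤ L := by omega
  have hKn : K * n + K ≤ K₀ * (n + 1) * L := by
    calc K * n + K = K * (n + 1) := by ring
      _ ≤ K₀ * L * (n + 1) := Nat.mul_le_mul_right _ hK
      _ = K₀ * (n + 1) * L := by ring
  have hq' : q ≤ 2 * K₀ * (n + 1) * L := hq.trans (by
    calc 2 * (K * n + K) ≤ 2 * (K₀ * (n + 1) * L) := Nat.mul_le_mul_left _ hKn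
      _ = 2 * K₀ * (n + 1) * L := by ring)
  have hqq : q * q ≤ 4 * K₀ ^ 2 * (n + 1) ^ 2 * L ^ 2 := by
    calc q * q ≤ (2 * K₀ * (n + 1) * L) * (2 * K₀ * (n + 1) * L) := Nat.mul_le_mul hq' hq'
      _ = 4 * K₀ ^ 2 * (n + 1) ^ 2 * L ^ 2 := by ring
  have hLL : L ≤ L ^ 2 := by nlinarith
  -- termwise
  have t1 : 2 * dB + 2 * n + 16 ≤ (2 * dB + 2 * n + 16) * L ^ 2 := Nat.le_mul_of_pos_right _ (by positivity)
  have t2 : 2 * q ≤ (4 * K₀ * (n + 1)) * L ^ 2 := by nlinarith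
  have t3 : 2 * ℓ + ℓ ≤ 3 * L ^ 2 := by nlinarith
  have t4 : 2 * (K * n + K) ≤ (2 * K₀ * (n + 1)) * L ^ 2 := by nlinarith
  have t5 : 2 * K ≤ (2 * K₀) * L ^ 2 := by nlinarith
  have t6 : q * q ≤ (4 * K₀ ^ 2 * (n + 1) ^ 2) * L ^ 2 := hqq
  have hsum : (2 * dB + 2 * n + 16) + 4 * K₀ * (n + 1) + 3 + 2 * K₀ * (n + 1) + 2 * K₀ + 4 * K₀ ^ 2 * (n + 1) ^ 2 ≤
      2 * dB + 2 * n + 19 + 8 * K₀ * (n + 1) + 4 * K₀ ^ 2 * (n + 1) ^ 2 := by nlinarith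
  calc 2 * dB + 2 * q + 2 * ℓ + 2 * (K * n + K) + 2 * n + 2 * K + q * q + 16 + ℓ
      = (2 * dB + 2 * n + 16) + 2 * q + (2 * ℓ + ℓ) + 2 * (K * n + K) + 2 * K + q * q := by ring
    _ ≤ (2 * dB + 2 * n + 16) * L ^ 2 + (4 * K₀ * (n + 1)) * L ^ 2 + 3 * L ^ 2 + (2 * K₀ * (n + 1)) * L ^ 2 +
          (2 * K₀) * L ^ 2 + (4 * K₀ ^ 2 * (n + 1) ^ 2) * L ^ 2 := by gcongr
    _ = ((2 * dB + 2 * n + 16) + 4 * K₀ * (n + 1) + 3 + 2 * K₀ * (n + 1) + 2 * K₀ + 4 * K₀ ^ 2 * (n + 1) ^ 2) * L ^ 2 := by ring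
    _ ≤ (2 * dB + 2 * n + 19 + 8 * K₀ * (n + 1) + 4 * K₀ ^ 2 * (n + 1) ^ 2) * L ^ 2 := Nat.mul_le_mul_right _ hsum

/-- **The size bound is polynomial in the level**: `Q(recBound) ≤ A'·(ℓ+1)^{2 deg Q}` with
`A' = Q(1)·growA^{deg Q}`. [folklore] -/
noncomputable def growA' (n a b k₀ : ℕ) : ℕ := T5Q.eval 1 * growA n a b k₀ ^ T5Q.natDegree

/-- The polynomial growth. [folklore] -/
theorem eval_recBound_le (n a b k₀ ℓ : ℕ) : T5Q.eval (recBound n a b k₀ ℓ) ≤ growA' n a b k₀ * (ℓ + 1) ^ (2 * T5Q.natDegree) := by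
  have hA : 1 ≤ growA n a b k₀ * (ℓ + 1) ^ 2 := by
    have : 1 ≤ growA n a b k₀ := by rw [growA]; omega
    exact le_trans this (Nat.le_mul_of_pos_right _ (Nat.pow_pos (Nat.succ_pos ℓ)))
  calc T5Q.eval (recBound n a b k₀ ℓ) ≤ T5Q.eval (growA n a b k₀ * (ℓ + 1) ^ 2) := natPoly_eval_mono _ (recBound_le n a b k₀ ℓ)
    _ ≤ T5Q.eval 1 * (growA n a b k₀ * (ℓ + 1) ^ 2) ^ T5Q.natDegree := natPoly_eval_le_eval_one_mul_pow _ hA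
    _ = growA' n a b k₀ * (ℓ + 1) ^ (2 * T5Q.natDegree) := by rw [growA', mul_pow, ← pow_mul, mul_assoc]

/-- **Good levels from usefulness, quantitatively and uniformly in `n, a, b`**: for every `j`
there is `ℓ₀` (depending on `R`, `k₀`, `j` only) such that every `ℓ ≥ ℓ₀` with
`A'(n,a,b)·4^{deg Q} ≤ ℓ^j` is good. [cite: CarmosinoImpagliazzoKabanetsKolokolova2016, Thm. 5.1 (proof)] -/
theorem goodLevel_of_large {R : CombinatorialProperty} (hU : IsUsefulAgainstPPoly R) (k₀ j : ℕ) :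
    ∃ ℓ₀, ∀ n a b ℓ, ℓ₀ ≤ ℓ → growA' n a b k₀ * 4 ^ T5Q.natDegree ≤ ℓ ^ j → GoodLevel R n a b k₀ ℓ := by
  have h := hU (2 * T5Q.natDegree + j)
  rw [IsUsefulAgainstSize, Filter.eventually_atTop] at h
  obtain ⟨ℓ₀, hℓ₀⟩ := h
  refine ⟨max ℓ₀ 1, fun n a b ℓ hℓ hA g hg => lt_of_le_of_lt ?_ (hℓ₀ ℓ (le_of_max_le_left hℓ) g hg)⟩
  have hℓ1 : 1 ≤ ℓ := le_of_max_le_right hℓ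
  calc T5Q.eval (recBound n a b k₀ ℓ) ≤ growA' n a b k₀ * (ℓ + 1) ^ (2 * T5Q.natDegree) := eval_recBound_le n a b k₀ ℓ
    _ ≤ growA' n a b k₀ * (2 * ℓ) ^ (2 * T5Q.natDegree) := Nat.mul_le_mul_left _ (Nat.pow_le_pow_left (by omega) _)
    _ = growA' n a b k₀ * 4 ^ T5Q.natDegree * ℓ ^ (2 * T5Q.natDegree) := by
        rw [mul_pow, pow_mul, show (2 : ℕ) ^ 2 = 4 by norm_num, mul_assoc]
    _ ≤ ℓ ^ j * ℓ ^ (2 * T5Q.natDegree) := Nat.mul_le_mul_right _ hA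
    _ = ℓ ^ (2 * T5Q.natDegree + j) := by rw [← pow_add, add_comm]

/-- **Good levels exist.** [cite: CarmosinoImpagliazzoKabanetsKolokolova2016, Thm. 5.1 (proof)] -/
theorem exists_goodLevel {R : CombinatorialProperty} (hU : IsUsefulAgainstPPoly R) (n a b k₀ : ℕ) : ∃ ℓ, GoodLevel R n a b k₀ ℓ := by
  obtain ⟨ℓ₀, hℓ₀⟩ := goodLevel_of_large hU k₀ 1
  refine ⟨max ℓ₀ (growA' n a b k₀ * 4 ^ T5Q.natDegree), hℓ₀ n a b _ (le_max_left _ _) ?_⟩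
  rw [pow_one]; exact le_max_right _ _

/-- **The good level** `ℓg(n, a, b)` (least good level). [cite: CarmosinoImpagliazzoKabanetsKolokolova2016, Thm. 5.1 (proof)] -/
noncomputable def goodLvl {R : CombinatorialProperty} (hU : IsUsefulAgainstPPoly R) (k₀ n a b : ℕ) : ℕ := by
  classical exact Nat.find (exists_goodLevel hU n a b k₀)

/-- The good level is good. [folklore] -/
theorem goodLvl_good {R : CombinatorialProperty} (hU : IsUsefulAgainstPPoly R) (k₀ n a b : ℕ) : GoodLevel R n a b k₀ (goodLvl hU k₀ n a b) := by
  classical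
  rw [goodLvl]; exact Nat.find_spec (exists_goodLevel hU n a b k₀)

/-- The good level is below every good level. [folklore] -/
theorem goodLvl_le {R : CombinatorialProperty} (hU : IsUsefulAgainstPPoly R) (k₀ n a b : ℕ) {ℓ : ℕ} (h : GoodLevel R n a b k₀ ℓ) :
    goodLvl hU k₀ n a b ≤ ℓ := by
  classical
  rw [goodLvl]; exact Nat.find_min' _ h

end Literature.Computability.Learning
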